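import Literature.NumberTheory.EllipticCurves.CasselsTateSelfPairing
import Literature.Algebra.Homology.HeisenbergLevelStructure
import HarnessLib

/-!
# The Cassels–Tate pairing at level `m`: `⟨a, a⟩ = 0` from a theta group with a level structure
# (Cassels' alternation at EVEN levels, after Morgan–Smith)

Topic `NumberTheory/EllipticCurves`; namespace `Literature.NumberTheory.EllipticCurves`. One structure
(a package of hypotheses) and theorems: **no named fact is introduced** (D-0026); same explicit inputs as
`CasselsTateGeneralCase.lean` / `CasselsTateSelfPairing.lean` (`halt`, `hPT' : inv.SumInvLocalizationEqZero`,
`hH3`, `hfin`).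

`CasselsTateSelfPairing` proves `2⟨a, a⟩ = 0` for the general case of Milne's construction and hence the
alternation `⟨a, a⟩ = 0` at ODD levels; at even levels (`p = 2`) alternation is Cassels' theorem (Cassels
1962; Poonen–Stoll 1999) and was an INPUT (`hct_alt` of `CasselsTateLevelAssembly.isLevelPairing_ctLevelPairing`).
This file proves `⟨a, a⟩ = 0` at ANY level from a **theta group with a level structure** (Morgan–Smith,
*The Cassels–Tate pairing for finite Galois modules*, §5, Thm. 5.10 with vanishing Poonen–Stoll class):

* `LevelThetaDatum W m e … l` — a Heisenberg datum `Θ` (`Literature.Algebra.Homology.HeisenbergDatum`) of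
  `Γ_K` on `E[l·m²]` with values in `μ_{m²}` whose commutator form is `e_{m²} ∘ ([l] × [l])`, with
  continuous correction terms, a level structure (`HeisenbergDatum.LevelStructure`: an equivariant
  homomorphic section) over `[l]⁻¹[m]⁻¹(0) = E[l·m]`, and, at every place `v`, LIFTS of the local Kummer
  cocycles of level `m²` along `[l]` to crossed homomorphisms whose obstruction (Zarhin / Poonen–Rains)
  cocycle is a continuous coboundary (isotropy of the local Kummer condition for the quadratic refinement).
* For self-data `D` (`β' = β`) of the general case, the `2`-cochain `C = lconn β₂` of a cochain lift `β₂` of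
  `β₁` along `[l]` satisfies `dC = −β₁ ∪ dβ₁` (`HeisenbergDatum.LevelStructure.lconn_cocycle`), so that
  **`Ξ = β₁ ∪ β₁ − ε − C` is a GLOBAL continuous `2`-cocycle of `μ_{m²}`** (`levelCocycle`); at every place
  `Ξ_v = z_v + κ_v ∪ κ_v − ∂H_v` pointwise (`levelCochain_res_apply`; `HeisenbergDatum.LevelStructure.
  lconn_add_of_isCrossedHom` + the local lift), hence `inv_v(loc_v Ξ) = t_v` (`[κ_v ∪ κ_v] = 0`, isotropy of
  the local Kummer condition), and the reciprocity law gives **`∑_v t_v = 0`, i.e. `⟨a, a⟩ = 0`**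
  (`sumOn_self_eq_zero`, `ctGeneralFun_self_eq_zero_of_levelThetaDatum`).

The EXISTENCE of a level theta datum for an elliptic curve at `l = 2`, `2 ∣ m` (Mumford's theta group of
`2·[m]^*(O)` in the algebraic form of Morgan–Smith Def. 5.19, normalised by the Arf-invariant-`1` quadratic form
on `E[2]`; local isotropy from `kummerClass_cupProduct_kummerClass_eq_zero` at level `2m²` and Hilbert 90) is the
object of the sequel; this file is the reduction.

## References

* [MorganSmith2021CTP] A. Morgan, A. Smith, *The Cassels–Tate pairing for finite Galois modules*,
  arXiv:2103.08530, §5: Def. 5.1, 5.7, Lemmas 5.12–5.15, Prop. 5.16, Thm. 5.10 (alternation ⟺ the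
  Poonen–Stoll class lifts), §5.3–5.4 (theta groups for finite modules; Mumford's theta groups).
* [MilneADT2006] J. S. Milne, *Arithmetic Duality Theorems*, 2nd ed. (2006), Ch. I §6, Prop. 6.9, Rem. 6.10–6.11.
* [Cassels1962ArithmeticIV] J. W. S. Cassels, *Arithmetic on curves of genus 1, IV*, Crelle 211 (1962).
* [PoonenRains2012] B. Poonen, E. Rains, JAMS 25 (2012), §4.1 (Heisenberg group, quadratic form, isotropy).
-/

noncomputable section

open scoped Classical

universe u

namespace Literature.NumberTheory.EllipticCurves

open CategoryTheory _root_.WeierstrassCurve Field Function NumberField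
open Literature.NumberTheory.GaloisRepresentations Literature.NumberTheory.GaloisCohomology
open Literature.NumberTheory.GaloisRepresentations.DiscreteGaloisModule (mu MuCarrier pairing)
open Literature.Algebra.Homology
open scoped ContRepresentation

-- Cup products need `LocallyCompactSpace Γ`; as in the tree's cup-product files, the compactness of
-- absolute Galois groups is a local instance only.
attribute [local instance] absoluteGaloisGroup_compactSpace

-- `char K_v = 0` for the completions of a number field (the tree's theorem `charZero_placeCompletion`;
-- local instance, no override).
attribute [local instance] charZero_placeCompletion

/-! ## The algebra of the local identity -/

section Algebra

variable {A M : Type*} [AddCommGroup A] [AddCommGroup M] (w : A →+ A →+ M)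

/-- **The local identity of the level computation** as pure algebra for an alternating bi-additive `w` (atoms:
`X = β₁σ`, `Y = σ β₁τ`, `P = β₁(στ)`, `U = κσ`, `V = σ κτ`): `Ξ_v − z_v − κ∪κ + ∂h = e(β₁σ − κσ, σ(β₁τ − κτ)) = 0`
(hypothesis `hz`: both arguments are `m`-torsion points of `E[m²]`). [cite: MorganSmith2021CTP, §5 proof of Thm. 5.10] -/
theorem levelPairing_local_identity (hself : ∀ a, w a a = 0) (hswap : ∀ a b, w b a = -w a b)
    (X Y P U V : A) (hz : w (X - U) (Y - V) = 0) :
    w X Y - w (X - U) V - w (U + V) (Y - P + X) - w (X - U) V - w U V +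
      (w V (Y - V) - w (U + V) (P - (U + V)) + w U (X - U)) = 0 := by
  have key : w X Y - w (X - U) V - w (U + V) (Y - P + X) - w (X - U) V - w U V +
      (w V (Y - V) - w (U + V) (P - (U + V)) + w U (X - U)) = w (X - U) (Y - V) := by
    simp only [map_add, map_sub, AddMonoidHom.add_apply, AddMonoidHom.sub_apply, hself, sub_zero,
      add_zero, zero_add]
    rw [hswap Y V, hswap P U, hswap P V, hswap U V, hswap X U, hswap Y U, hswap X V]
    abel
  rw [key, hz]

end Algebra

section Level

variable {K : Type u} [Field K] [NumberField K] (W : WeierstrassCurve K) (m : ℕ) [NeZero m]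
variable (e : geomTorsion W ((m * m : ℕ) : ℤ) → geomTorsion W ((m * m : ℕ) : ℤ) → AlgebraicClosure K)
  (hμ : ∀ S T, e S T ^ (m * m) = 1)
  (hadd₁ : ∀ S₁ S₂ T, e (S₁ + S₂) T = e S₁ T * e S₂ T)
  (hadd₂ : ∀ S T₁ T₂, e S (T₁ + T₂) = e S T₁ * e S T₂)
  (hgal : ∀ (σ : absoluteGaloisGroup K) (S T : geomTorsion W ((m * m : ℕ) : ℤ)),
    σ • e S T = e (σ • S) (σ • T))
  (l : ℕ) [NeZero l]

/-- **A theta group with a level structure for `(E, m)` at the auxiliary level `l`** (the hypotheses of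
Morgan–Smith Thm. 5.10 for the sequence `0 → E[l·m] → E[l·m²] → E[m] → 0` with vanishing Poonen–Stoll class,
in the cochain language of the tree):

* `Θ` — a Heisenberg datum (`Literature.Algebra.Homology.HeisenbergDatum`: central extension of `Γ_K`-groups
  `0 → μ_{m²} → V → E[l·m²] → 0` with a set-theoretic section) whose module and value actions are the Galois
  actions (`ρ_eq`, `α_eq`), whose commutator form is `e ∘ ([l] × [l])` (`commForm_eq`) and whose correction terms
  are continuous (`continuous_χ`);
* `L` — a level structure on `Θ` (`HeisenbergDatum.LevelStructure`: an equivariant homomorphic section `t`)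
  over the points killed by `[m] ∘ [l]` (`mem_M₀`);
* `iso` — at every place `v`, every local Kummer cocycle `κ` of level `m²` lifts along `[l]` to a continuous
  crossed homomorphism `κ̃` whose obstruction cocycle `conn κ̃` (the Zarhin / Poonen–Rains quadratic refinement
  of the cup product) is a continuous coboundary: isotropy of the local Kummer condition for the quadratic map.

[cite: MorganSmith2021CTP, §5 Def. 5.1, 5.7, Assumption 5.5 and Thm. 5.10] -/
structure LevelThetaDatum where
  /-- the Heisenberg datum of `Γ_K` on `E[l·m²]` with values in `μ_{m²}` -/
  Θ : HeisenbergDatum (absoluteGaloisGroup K) (geomTorsion W ((l * (m * m) : ℕ) : ℤ)) (MuCarrier K (m * m))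
  /-- its module action is the Galois action on `E[l·m²]` -/
  ρ_eq : ∀ (σ : absoluteGaloisGroup K) (x : geomTorsion W ((l * (m * m) : ℕ) : ℤ)), Θ.ρ σ x = σ • x
  /-- its value action is the Galois action on `μ_{m²}` -/
  α_eq : ∀ (σ : absoluteGaloisGroup K) (z : MuCarrier K (m * m)), Θ.α σ z = (mu K (m * m)).toTopRep.ρ σ z
  /-- its commutator form is `e_{m²}([l] x, [l] y)` -/
  commForm_eq : ∀ x y, Θ.commForm x y =
    weilPairingHom W (m * m) e hμ hadd₁ hadd₂ (mulK W l (m * m) x) (mulK W l (m * m) y)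
  /-- the correction terms `σ ↦ χ_σ(x)` are continuous -/
  continuous_χ : ∀ x, Continuous fun σ : absoluteGaloisGroup K => Θ.χ σ x
  /-- the level structure -/
  L : Θ.LevelStructure
  /-- … is over `E[l·m] = {x : [m][l] x = 0}` -/
  mem_M₀ : ∀ x, mulK W m m (mulK W l (m * m) x) = 0 → x ∈ L.M₀
  /-- local isotropy: Kummer cocycles of level `m²` lift along `[l]` to crossed homomorphisms with principal
  obstruction cocycle -/
  iso : ∀ (v : Place K) (κ : contOneCocycles (torsionRepAt W (Place.Completion v) ((m * m : ℕ) : ℤ))),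
    locClass _ (Place.Completion v) κ ∈ W.kummerLocalConditionAt ((m * m : ℕ) : ℤ) (Place.Completion v) →
    ∃ κl : contOneCocycles (torsionRepAt W (Place.Completion v) ((l * (m * m) : ℕ) : ℤ)),
      (∀ σ, mulK W l (m * m) (κl.1 σ) = κ.1 σ) ∧
      ∃ b : C(absoluteGaloisGroup (Place.Completion v), muRepAt (K := K) m (Place.Completion v)),
        ∀ σ τ, (Θ.comap (absGaloisRestrict K (Place.Completion v) :
              absoluteGaloisGroup (Place.Completion v) →ₜ* absoluteGaloisGroup K).toMonoidHom).conn
            (fun σ => κl.1 σ) σ τ =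
          (mu K (m * m)).toTopRep.ρ (absGaloisRestrict K (Place.Completion v) σ) (b τ) - b (σ * τ) + b σ

/-! ### Cochain lifts along `[l]` -/

/-- **A cochain lift along `[l]`** of a continuous `1`-cochain `β₁ : Γ_K → E[m²]`: `β₂ = s ∘ β₁` for a
set-theoretic section `s` of `[l] : E[l·m²] → E[m²]`. [cite: MilneADT2006, Ch. I §6, proof of Prop. 6.9 (cochain lifts)] -/
def liftAlong (β₁ : C(absoluteGaloisGroup K, geomTorsion W ((m * m : ℕ) : ℤ))) :
    C(absoluteGaloisGroup K, geomTorsion W ((l * (m * m) : ℕ) : ℤ)) :=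
  (⟨kRoot W l (m * m), continuous_of_discreteTopology⟩ :
    C(geomTorsion W ((m * m : ℕ) : ℤ), geomTorsion W ((l * (m * m) : ℕ) : ℤ))).comp β₁

omit [NeZero m] in
/-- `[l] ∘ liftAlong β₁ = β₁`. [cite: MilneADT2006, Ch. I §6, proof of Prop. 6.9 (cochain lifts)] -/
@[simp]
theorem mulK_liftAlong (β₁ : C(absoluteGaloisGroup K, geomTorsion W ((m * m : ℕ) : ℤ))) (σ : absoluteGaloisGroup K) :
    mulK W l (m * m) (liftAlong W m l β₁ σ) = β₁ σ :=
  mulK_kRoot W l (m * m) (β₁ σ)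

variable {W m e hμ hadd₁ hadd₂ hgal l}

namespace LevelThetaDatum

variable (T : LevelThetaDatum W m e hμ hadd₁ hadd₂ l) (D : GeneralCaseData W m e hμ hadd₁ hadd₂ hgal)

/-- `[l] (dβ₂(σ,τ)) = dβ₁(σ,τ) = ι f(σ,τ)` for the cochain lift `β₂ = liftAlong β₁`. [cite: MorganSmith2021CTP, §5 Prop. 5.16 (da is valued in ι(M₁))] -/
theorem mulK_cobd_β₂ (σ τ : absoluteGaloisGroup K) :
    mulK W l (m * m) (T.Θ.cobd (liftAlong W m l D.β₁) σ τ) = σ • D.β₁ τ - D.β₁ (σ * τ) + D.β₁ σ := by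
  rw [HeisenbergDatum.cobd_apply, map_add, map_sub, T.ρ_eq, mulK_smul, mulK_liftAlong, mulK_liftAlong,
    mulK_liftAlong]

/-- `dβ₂` takes values in the sub-object `E[l·m]` of the level structure (`[m] dβ₁ = [m] ι f = 0`). [cite: MorganSmith2021CTP, §5 Prop. 5.16 (da is valued in ι(M₁))] -/
theorem cobd_β₂_mem (σ τ : absoluteGaloisGroup K) : T.Θ.cobd (liftAlong W m l D.β₁) σ τ ∈ T.L.M₀ :=
  T.mem_M₀ _ (by rw [T.mulK_cobd_β₂ D σ τ, ← D.inclKD_f σ τ, mulK_inclKD])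

/-! ### The `2`-cochain `C = lconn β₂` and `dC = −β₁ ∪ dβ₁` -/

/-- The level connecting cochain of `β₂` as a function on `Γ_K × Γ_K`. [cite: MorganSmith2021CTP, §5 Prop. 5.16 (the cochain db − s∘A₁)] -/
def levelConnFun : absoluteGaloisGroup K × absoluteGaloisGroup K → MuCarrier K (m * m) :=
  fun p => T.L.lconn (liftAlong W m l D.β₁) p.1 p.2

/-- **Continuity of `C = lconn β₂`**: `C(σ,τ) = χ_σ(β₂τ) + m(β₂σ, σβ₂τ) − m(dβ₂(σ,τ), β₂(στ)) − λ(dβ₂(σ,τ))`; the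
last three terms factor through the continuous map `(σ,τ) ↦ (β₂σ, σβ₂τ, β₂(στ))` into the discrete `E[l·m²]³`,
the first through `(σ,τ) ↦ (σ, β₂τ)` and the continuity of `σ ↦ χ_σ(x)`. [cite: SerreGaloisCohomology1997, I §2.2 (continuous cochains)] -/
theorem continuous_levelConnFun : Continuous (T.levelConnFun D) := by
  have hβ : Continuous (liftAlong W m l D.β₁) := (liftAlong W m l D.β₁).continuous
  -- the correction term
  have h1 : Continuous fun p : absoluteGaloisGroup K × absoluteGaloisGroup K => T.Θ.χ p.1 (liftAlong W m l D.β₁ p.2) := by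
    rw [continuous_discrete_rng]
    intro c
    rw [isOpen_iff_forall_mem_open]
    rintro ⟨σ₀, τ₀⟩ h0
    refine ⟨{σ | T.Θ.χ σ (liftAlong W m l D.β₁ τ₀) = c} ×ˢ {τ | liftAlong W m l D.β₁ τ = liftAlong W m l D.β₁ τ₀}, ?_, ?_, ?_⟩
    · rintro ⟨σ, τ⟩ ⟨hσ, hτ⟩
      simp only [Set.mem_setOf_eq] at hσ hτ
      simp only [Set.mem_preimage, Set.mem_singleton_iff, hτ]
      exact hσ
    · exact ((isOpen_discrete {c}).preimage (T.continuous_χ (liftAlong W m l D.β₁ τ₀))).prod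
        ((isOpen_discrete {liftAlong W m l D.β₁ τ₀}).preimage hβ)
    · exact ⟨h0, rfl⟩
  -- the three discrete arguments
  have h2 : Continuous fun p : absoluteGaloisGroup K × absoluteGaloisGroup K =>
      (liftAlong W m l D.β₁ p.1, (p.1 • liftAlong W m l D.β₁ p.2, liftAlong W m l D.β₁ (p.1 * p.2))) :=
    (hβ.comp continuous_fst).prodMk
      (((W.torsionGaloisModule ((l * (m * m) : ℕ) : ℤ)).continuous_apply₂.comp
        (continuous_fst.prodMk (hβ.comp continuous_snd))).prodMk (hβ.comp continuous_mul))
  have heq : T.levelConnFun D = (fun t : MuCarrier K (m * m) ×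
        (geomTorsion W ((l * (m * m) : ℕ) : ℤ) × (geomTorsion W ((l * (m * m) : ℕ) : ℤ) ×
          geomTorsion W ((l * (m * m) : ℕ) : ℤ))) =>
      t.1 + T.Θ.m t.2.1 t.2.2.1 - T.Θ.m (t.2.2.1 - t.2.2.2 + t.2.1) t.2.2.2 - T.L.lam (t.2.2.1 - t.2.2.2 + t.2.1)) ∘
      (fun p : absoluteGaloisGroup K × absoluteGaloisGroup K =>
        (T.Θ.χ p.1 (liftAlong W m l D.β₁ p.2), (liftAlong W m l D.β₁ p.1, (p.1 • liftAlong W m l D.β₁ p.2, liftAlong W m l D.β₁ (p.1 * p.2))))) := by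
    funext p
    simp only [Function.comp_apply, levelConnFun, HeisenbergDatum.LevelStructure.lconn_apply,
      HeisenbergDatum.cobd_apply, T.ρ_eq]
  rw [heq]
  exact continuous_of_discreteTopology.comp (h1.prodMk h2)

/-- **The `2`-cochain `C = lconn β₂ ∈ C²(Γ_K, μ_{m²})`** (Morgan–Smith's `db − s∘A₁` for the lift `b = s ∘ β₂`).
[cite: MorganSmith2021CTP, §5 Prop. 5.16 (the cochain db − s∘A₁)] -/
def levelConn : C(absoluteGaloisGroup K × absoluteGaloisGroup K, MuCarrier K (m * m)) :=
  ⟨T.levelConnFun D, T.continuous_levelConnFun D⟩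

/-- Unfolding `levelConn`. [cite: MorganSmith2021CTP, §5 Prop. 5.16 (the cochain db − s∘A₁)] -/
@[simp]
theorem levelConn_apply (σ τ : absoluteGaloisGroup K) : T.levelConn D (σ, τ) = T.L.lconn (liftAlong W m l D.β₁) σ τ := rfl

/-- **`dC = B`**, `B(σ,τ,υ) = desc(σ f(τ,υ), βσ) = −e(β₁σ, σ dβ₁(τ,υ))` (`HeisenbergDatum.LevelStructure.lconn_cocycle`:
`dC = −β₂ ∪_Θ dβ₂`, the commutator form of `Θ` being `e ∘ ([l] × [l])`). [cite: MorganSmith2021CTP, §5 Lemma 5.12 and Prop. 5.16 (1)] -/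
theorem dTwo_levelConn (halt : ∀ T, e T T = 1) (σ τ υ : absoluteGaloisGroup K) :
    dTwo (mu K (m * m)).toTopRep (T.levelConn D) σ τ υ =
      descendHom W m m e hμ hadd₁ hadd₂ (σ • D.f.1 (τ, υ)) (D.β.1 σ) := by
  have key := T.L.lconn_cocycle (β := liftAlong W m l D.β₁) (fun g h => T.cobd_β₂_mem D g h) σ τ υ
  rw [T.commForm_eq, mulK_liftAlong, T.ρ_eq, mulK_smul, T.mulK_cobd_β₂ D, T.α_eq] at key
  rw [smul_add, smul_sub, smul_smul] at key
  rw [dTwo_apply, levelConn_apply, levelConn_apply, levelConn_apply, levelConn_apply,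
    D.descendHom_smul_f_β, weilPairingHom_swap_eq_neg W (m * m) e hμ hadd₁ hadd₂ halt (D.β₁ σ)]
  linear_combination (norm := abel) key

/-! ### The global `2`-cocycle `Ξ = β₁ ∪ β₁ − ε − C` -/

/-- **The global `2`-cochain `Ξ = β₁ ∪ β₁ − ε − C`** of self-data with a level theta datum. [cite: MorganSmith2021CTP, §5 proof of Thm. 5.10 (the cochain η)] -/
def levelCochain : C(absoluteGaloisGroup K × absoluteGaloisGroup K, MuCarrier K (m * m)) :=
  D.betaCup - D.ε - T.levelConn D

/-- Unfolding `levelCochain`. [cite: MorganSmith2021CTP, §5 proof of Thm. 5.10 (the cochain η)] -/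
theorem levelCochain_apply (σ τ : absoluteGaloisGroup K) :
    T.levelCochain D (σ, τ) =
      weilPairingHom W (m * m) e hμ hadd₁ hadd₂ (D.β₁ σ) (σ • D.β₁ τ) - D.ε (σ, τ) - T.L.lconn (liftAlong W m l D.β₁) σ τ :=
  rfl

/-- **`Ξ` is a `2`-cocycle** when `β' = β`: `dΞ = (A + B) − A − B = 0`. [cite: MorganSmith2021CTP, §5 Prop. 5.16 (1) and proof of Thm. 5.10] -/
theorem dTwo_levelCochain (halt : ∀ T, e T T = 1) (hβ' : D.β' = D.β) (σ τ υ : absoluteGaloisGroup K) :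
    dTwo (mu K (m * m)).toTopRep (T.levelCochain D) σ τ υ = 0 := by
  rw [levelCochain, dTwo_sub, dTwo_sub, D.dTwo_betaCup halt, D.dTwo_eps_of_self hβ', T.dTwo_levelConn D halt]
  abel

/-- **The global `2`-cocycle `Ξ`**. [cite: MorganSmith2021CTP, §5 proof of Thm. 5.10 (the cochain η)] -/
def levelCocycle (halt : ∀ T, e T T = 1) (hβ' : D.β' = D.β) : contTwoCocycles (mu K (m * m)).toTopRep :=
  ⟨T.levelCochain D, (mem_contTwoCocycles_iff_dTwo _ _).2 (T.dTwo_levelCochain D halt hβ')⟩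

/-! ### The local identity `Ξ_v = z_v + κ_v ∪ κ_v − ∂H_v` -/

section Local

variable (v : Place K)

/-- `Γ_{K_v} → Γ_K` as a monoid homomorphism (the tree's `absGaloisRestrict`, for pulling back Heisenberg data).
[cite: SerreGaloisCohomology1997, I §2.4 and I §5.8 (compatible pairs, functoriality)] -/
abbrev resHom : absoluteGaloisGroup (Place.Completion v) →* absoluteGaloisGroup K :=
  (absGaloisRestrict K (Place.Completion v) :
    absoluteGaloisGroup (Place.Completion v) →ₜ* absoluteGaloisGroup K).toMonoidHom

omit [NeZero m] in
/-- Unfolding `resHom`. [cite: SerreGaloisCohomology1997, I §2.4 and I §5.8 (compatible pairs, functoriality)] -/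
@[simp]
theorem resHom_apply (σ : absoluteGaloisGroup (Place.Completion v)) :
    resHom (K := K) v σ = absGaloisRestrict K (Place.Completion v) σ := rfl

/-- **The local lift `κ̃_v` of `κ_v` along `[l]`** provided by `iso`. [cite: MorganSmith2021CTP, §5 proof of Thm. 5.10 (the local representatives φ_{v,M})] -/
def kl : contOneCocycles (torsionRepAt W (Place.Completion v) ((l * (m * m) : ℕ) : ℤ)) :=
  (T.iso v (D.κ v) (D.κ_mem v)).choose

omit [NeZero l] in
/-- `[l] ∘ κ̃_v = κ_v`. [cite: MorganSmith2021CTP, §5 proof of Thm. 5.10 (the local representatives φ_{v,M})] -/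
@[simp]
theorem mulK_kl (σ : absoluteGaloisGroup (Place.Completion v)) :
    mulK W l (m * m) ((T.kl D v).1 σ) = (D.κ v).1 σ :=
  (T.iso v (D.κ v) (D.κ_mem v)).choose_spec.1 σ

/-- **The splitting cochain `b_v`** of the obstruction cocycle of `κ̃_v` provided by `iso`. [cite: MorganSmith2021CTP, §5 Def. 5.3 (isotropy of the local conditions)] -/
def bl : C(absoluteGaloisGroup (Place.Completion v), muRepAt (K := K) m (Place.Completion v)) :=
  (T.iso v (D.κ v) (D.κ_mem v)).choose_spec.2.choose

omit [NeZero l] in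
/-- `conn κ̃_v = ∂b_v`. [cite: MorganSmith2021CTP, §5 Def. 5.3 (isotropy of the local conditions)] -/
theorem conn_kl (σ τ : absoluteGaloisGroup (Place.Completion v)) :
    (T.Θ.comap (resHom v)).conn (fun σ => (T.kl D v).1 σ) σ τ =
      (mu K (m * m)).toTopRep.ρ (absGaloisRestrict K (Place.Completion v) σ) (T.bl D v τ) -
        T.bl D v (σ * τ) + T.bl D v σ :=
  (T.iso v (D.κ v) (D.κ_mem v)).choose_spec.2.choose_spec σ τ

/-- **`γ̃_v = β_{2,v} − κ̃_v`**, an `E[l·m]`-valued continuous `1`-cochain on `Γ_v` lifting `β_{1,v} − κ_v`.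
[cite: MorganSmith2021CTP, §5 Prop. 5.16 (2) (the cochain a₁)] -/
def gl : C(absoluteGaloisGroup (Place.Completion v), geomTorsion W ((l * (m * m) : ℕ) : ℤ)) :=
  ⟨fun σ => liftAlong W m l D.β₁ (absGaloisRestrict K (Place.Completion v) σ) - (T.kl D v).1 σ,
    ((liftAlong W m l D.β₁).continuous.comp (absGaloisRestrict K (Place.Completion v)).continuous).sub
      (T.kl D v).1.continuous⟩

/-- Unfolding `gl`. [cite: MorganSmith2021CTP, §5 Prop. 5.16 (2) (the cochain a₁)] -/
@[simp]
theorem gl_apply (σ : absoluteGaloisGroup (Place.Completion v)) :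
    T.gl D v σ = liftAlong W m l D.β₁ (absGaloisRestrict K (Place.Completion v) σ) - (T.kl D v).1 σ := rfl

/-- `[l] γ̃_v = β_{1,v} − κ_v`. [cite: MorganSmith2021CTP, §5 Prop. 5.16 (2) (the cochain a₁)] -/
theorem mulK_gl (σ : absoluteGaloisGroup (Place.Completion v)) :
    mulK W l (m * m) (T.gl D v σ) = D.β₁ (absGaloisRestrict K (Place.Completion v) σ) - (D.κ v).1 σ := by
  rw [gl_apply, map_sub, mulK_liftAlong, mulK_kl]

/-- `γ̃_v` takes values in `E[l·m]` (`[m](β_{1,v} − κ_v) = 0`). [cite: MorganSmith2021CTP, §5 Prop. 5.16 (2) (the cochain a₁)] -/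
theorem gl_mem (σ : absoluteGaloisGroup (Place.Completion v)) : T.gl D v σ ∈ T.L.M₀ :=
  T.mem_M₀ _ (by rw [mulK_gl]; exact (D.localData v).mulK_sub σ)

omit [NeZero l] in
/-- `κ̃_v` is a crossed homomorphism for the pulled-back datum. [cite: SerreGaloisCohomology1997, I §5.1 (cocycles, crossed homomorphisms)] -/
theorem isCrossedHom_kl : (T.Θ.comap (resHom v)).IsCrossedHom (fun σ => (T.kl D v).1 σ) := fun σ τ => by
  rw [HeisenbergDatum.comap_ρ_apply, resHom_apply, T.ρ_eq]
  exact (T.kl D v).2 σ τ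

/-- The `μ`-cochain as a function: `μ_v(σ) = −(λ(γ̃_v σ) + m(κ̃_v σ, γ̃_v σ))`. [cite: MorganSmith2021CTP, §5 Prop. 5.16 (2)] -/
def muFun : absoluteGaloisGroup (Place.Completion v) → MuCarrier K (m * m) :=
  fun σ => -(T.L.lam (T.gl D v σ) + T.Θ.m ((T.kl D v).1 σ) (T.gl D v σ))

/-- `μ_v` is continuous (it factors through the discrete `E[l·m²]²`). [cite: SerreGaloisCohomology1997, I §2.2 (continuous cochains)] -/
theorem continuous_muFun : Continuous (T.muFun D v) := by
  have h : T.muFun D v =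
      (fun q : geomTorsion W ((l * (m * m) : ℕ) : ℤ) × geomTorsion W ((l * (m * m) : ℕ) : ℤ) =>
        -(T.L.lam q.2 + T.Θ.m q.1 q.2)) ∘ (fun σ => ((T.kl D v).1 σ, T.gl D v σ)) := rfl
  rw [h]
  exact continuous_of_discreteTopology.comp ((T.kl D v).1.continuous.prodMk (T.gl D v).continuous)

/-- **The `μ`-cochain** `μ_v(σ) = −(λ(γ̃_v σ) + m(κ̃_v σ, γ̃_v σ))` of the local decomposition
(`HeisenbergDatum.LevelStructure.lconn_add_of_isCrossedHom`), as a continuous cochain. [cite: MorganSmith2021CTP, §5 Prop. 5.16 (2)] -/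
def muCochain : C(absoluteGaloisGroup (Place.Completion v), muRepAt (K := K) m (Place.Completion v)) :=
  ⟨T.muFun D v, T.continuous_muFun D v⟩

/-- Unfolding `muCochain`. [cite: MorganSmith2021CTP, §5 Prop. 5.16 (2)] -/
@[simp]
theorem muCochain_apply (σ : absoluteGaloisGroup (Place.Completion v)) :
    T.muCochain D v σ = -(T.L.lam (T.gl D v σ) + T.Θ.m ((T.kl D v).1 σ) (T.gl D v σ)) := rfl

/-- **The local `1`-cochain `H_v = b_v + μ_v + h_v`** (`h_v(σ) = e(κ_v σ, β_{1,v}σ − κ_v σ)`, the tree's `hLoc`).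
[cite: MorganSmith2021CTP, §5 proof of Thm. 5.10] -/
def hLocLevel : C(absoluteGaloisGroup (Place.Completion v), muRepAt (K := K) m (Place.Completion v)) :=
  T.bl D v + T.muCochain D v + D.hLoc v

/-- Unfolding `hLocLevel`. [cite: MorganSmith2021CTP, §5 proof of Thm. 5.10] -/
theorem hLocLevel_apply (σ : absoluteGaloisGroup (Place.Completion v)) :
    T.hLocLevel D v σ = T.bl D v σ + T.muCochain D v σ + D.hLoc v σ := rfl

/-- **The local decomposition of `C`** at `v` (`HeisenbergDatum.LevelStructure.lconn_add_of_isCrossedHom` for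
`β_{2,v} = κ̃_v + γ̃_v`, read through `[l]`): with `X = β₁σ`, `U = κσ`, `V = σκτ`,
`C(σ,τ) = ∂b(σ,τ) + e(X − U, V) + e(κ(στ), σ(β₁τ − κτ) − (β₁(στ) − κ(στ)) + (X − U)) + ∂μ(σ,τ)`.
[cite: MorganSmith2021CTP, §5 Prop. 5.16 (2)] -/
theorem lconn_res_apply (σ τ : absoluteGaloisGroup (Place.Completion v)) :
    T.L.lconn (liftAlong W m l D.β₁) (absGaloisRestrict K (Place.Completion v) σ)
        (absGaloisRestrict K (Place.Completion v) τ) =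
      ((mu K (m * m)).toTopRep.ρ (absGaloisRestrict K (Place.Completion v) σ) (T.bl D v τ) -
          T.bl D v (σ * τ) + T.bl D v σ) +
      weilPairingHom W (m * m) e hμ hadd₁ hadd₂
          (D.β₁ (absGaloisRestrict K (Place.Completion v) σ) - (D.κ v).1 σ)
          (absGaloisRestrict K (Place.Completion v) σ • (D.κ v).1 τ) +
      weilPairingHom W (m * m) e hμ hadd₁ hadd₂ ((D.κ v).1 (σ * τ))
          (absGaloisRestrict K (Place.Completion v) σ •
              (D.β₁ (absGaloisRestrict K (Place.Completion v) τ) - (D.κ v).1 τ) -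
            (D.β₁ (absGaloisRestrict K (Place.Completion v) (σ * τ)) - (D.κ v).1 (σ * τ)) +
            (D.β₁ (absGaloisRestrict K (Place.Completion v) σ) - (D.κ v).1 σ)) +
      ((mu K (m * m)).toTopRep.ρ (absGaloisRestrict K (Place.Completion v) σ) (T.muCochain D v τ) -
          T.muCochain D v (σ * τ) + T.muCochain D v σ) := by
  have hdec := (T.L.comap (resHom v)).lconn_add_of_isCrossedHom (T.isCrossedHom_kl D v)
    (γ := fun σ => T.gl D v σ) (fun σ => T.gl_mem D v σ) σ τ
  have hfun : ((fun σ => (T.kl D v).1 σ) + fun σ => T.gl D v σ) =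
      (liftAlong W m l D.β₁ : absoluteGaloisGroup K → geomTorsion W ((l * (m * m) : ℕ) : ℤ)) ∘ resHom v := by
    funext σ
    simp only [Pi.add_apply, gl_apply, Function.comp_apply, resHom_apply]
    abel
  rw [hfun, HeisenbergDatum.LevelStructure.lconn_comp, resHom_apply, resHom_apply, T.conn_kl D v σ τ] at hdec
  rw [hdec]
  simp only [HeisenbergDatum.commForm_comap, HeisenbergDatum.comap_ρ_apply, HeisenbergDatum.comap_α_apply,
    HeisenbergDatum.comap_m, HeisenbergDatum.LevelStructure.comap_lam, HeisenbergDatum.cobd_apply, resHom_apply,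
    T.commForm_eq, T.ρ_eq, mulK_smul, mulK_gl, map_add (mulK W l (m * m)), map_sub (mulK W l (m * m))]
  rw [T.α_eq, mulK_kl, mulK_kl]
  rfl

/-- **The local identity** `Ξ_v = z_v + κ_v ∪ κ_v − ∂H_v` on `Γ_v × Γ_v` (module docstring).
[cite: MorganSmith2021CTP, §5 proof of Thm. 5.10] -/
theorem levelCochain_res_apply (halt : ∀ T, e T T = 1) (hβ' : D.β' = D.β)
    (σ τ : absoluteGaloisGroup (Place.Completion v)) :
    T.levelCochain D (absGaloisRestrict K (Place.Completion v) σ, absGaloisRestrict K (Place.Completion v) τ) =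
      (D.localData v).cocycle.1 (σ, τ) +
        (weilCup W m (Place.Completion v) e hμ hadd₁ hadd₂ hgal (D.κ v) (D.κ v)).1 (σ, τ) -
        ((mu K (m * m)).toTopRep.ρ (absGaloisRestrict K (Place.Completion v) σ) (T.hLocLevel D v τ) -
          T.hLocLevel D v (σ * τ) + T.hLocLevel D v σ) := by
  have hκ2 : (D.κ v).1 (σ * τ) = (D.κ v).1 σ + absGaloisRestrict K (Place.Completion v) σ • (D.κ v).1 τ :=
    (D.κ v).2 σ τ
  rw [levelCochain_apply, T.lconn_res_apply D v σ τ, D.cocycle_apply_of_self hβ' v, weilCup_apply,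
    hLocLevel_apply, hLocLevel_apply, hLocLevel_apply, map_add, map_add, GeneralCaseData.hLoc_apply,
    GeneralCaseData.hLoc_apply, GeneralCaseData.hLoc_apply,
    GeneralCaseData.smul_weilPairingHom (hμ := hμ) (hadd₁ := hadd₁) (hadd₂ := hadd₂) hgal, hκ2]
  have hloc := levelPairing_local_identity (weilPairingHom W (m * m) e hμ hadd₁ hadd₂)
    (weilPairingHom_self W (m * m) e hμ hadd₁ hadd₂ halt) (weilPairingHom_swap_eq_neg W (m * m) e hμ hadd₁ hadd₂ halt)
    (D.β₁ (absGaloisRestrict K (Place.Completion v) σ))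
    (absGaloisRestrict K (Place.Completion v) σ • D.β₁ (absGaloisRestrict K (Place.Completion v) τ))
    (D.β₁ (absGaloisRestrict K (Place.Completion v) (σ * τ)))
    ((D.κ v).1 σ) (absGaloisRestrict K (Place.Completion v) σ • (D.κ v).1 τ)
    (D.weilPairingHom_sub_sub_eq_zero v σ τ)
  simp only [map_add, map_sub, AddMonoidHom.add_apply, AddMonoidHom.sub_apply, smul_sub] at hloc ⊢
  linear_combination (norm := abel) hloc

/-- **The local class of `Ξ`**: `[Ξ_v] = [z_v] + [κ_v ∪ κ_v]` in `H²(K_v, μ_{m²})` (`∂H_v` is a coboundary).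
[cite: MorganSmith2021CTP, §5 proof of Thm. 5.10] -/
theorem locClass₂_res_levelCocycle (halt : ∀ T, e T T = 1) (hβ' : D.β' = D.β) :
    locClass₂ (mu K (m * m)) (Place.Completion v)
        (resTwo (mu K (m * m)) (Place.Completion v) (T.levelCocycle D halt hβ')) =
      locClass₂ _ _ (D.localData v).cocycle +
        locClass₂ _ _ (weilCup W m (Place.Completion v) e hμ hadd₁ hadd₂ hgal (D.κ v) (D.κ v)) := by
  rw [← locClass₂_add, ← sub_eq_zero, ← locClass₂_sub]
  refine (twoCocycleClass_eq_zero_iff _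
    (resTwo (mu K (m * m)) (Place.Completion v) (T.levelCocycle D halt hβ') -
      ((D.localData v).cocycle + weilCup W m (Place.Completion v) e hμ hadd₁ hadd₂ hgal (D.κ v) (D.κ v)))).2
    ⟨-T.hLocLevel D v, fun σ τ => ?_⟩
  change T.levelCochain D (absGaloisRestrict K (Place.Completion v) σ, absGaloisRestrict K (Place.Completion v) τ) -
      ((D.localData v).cocycle.1 (σ, τ) +
        (weilCup W m (Place.Completion v) e hμ hadd₁ hadd₂ hgal (D.κ v) (D.κ v)).1 (σ, τ)) =
    (mu K (m * m)).toTopRep.ρ (absGaloisRestrict K (Place.Completion v) σ) ((-T.hLocLevel D v) τ) -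
      (-T.hLocLevel D v) (σ * τ) + (-T.hLocLevel D v) σ
  rw [T.levelCochain_res_apply D v halt hβ' σ τ, ContinuousMap.neg_apply, ContinuousMap.neg_apply,
    ContinuousMap.neg_apply, map_neg]
  abel

/-- **`inv_v(loc_v Ξ) = t_v`**: the class `[κ_v ∪ κ_v]` is killed by the isotropy of the local Kummer condition
(discharged fact `kummerClass_cupProduct_kummerClass_eq_zero_holds`). [cite: MorganSmith2021CTP, §5 proof of Thm. 5.10] -/
theorem inv_locClass₂_res_levelCocycle [W.IsElliptic] (inv : LocalInvariants K (m * m)) (halt : ∀ T, e T T = 1)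
    (hβ' : D.β' = D.β) :
    inv v (locClass₂ (mu K (m * m)) (Place.Completion v)
      (resTwo (mu K (m * m)) (Place.Completion v) (T.levelCocycle D halt hβ'))) = D.localTerm inv v := by
  have hcl := T.locClass₂_res_levelCocycle D v halt hβ'
  rw [locClass₂_weilCup, weilLocalCup_eq_zero_of_mem_of_fact W m (Place.Completion v) e hμ hadd₁ hadd₂ hgal
    (kummerClass_cupProduct_kummerClass_eq_zero_holds (Place.Completion v)) halt (D.κ_mem v) (D.κ_mem v),
    add_zero] at hcl
  unfold GeneralCaseData.localTerm GeneralLocalData.term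
  exact congrArg (inv v) hcl

end Local

/-! ### `⟨a, a⟩ = 0` -/

include T in
-- `hPT'` is the reciprocity PREDICATE `LocalInvariants.SumInvLocalizationEqZero` on `inv`, not a named fact.
/-- **`∑_{v ∈ S} t_v = 0` for self-data** (`β' = β`) whose local terms vanish outside `S`, given a level theta
datum: `∑_v inv_v(loc_v Ξ) = 0` for the global `2`-cocycle `Ξ` by the reciprocity law, and `inv_v(loc_v Ξ) = t_v`.
[cite: MorganSmith2021CTP, §5 Thm. 5.10] -/
theorem sumOn_self_eq_zero [W.IsElliptic] (inv : LocalInvariants K (m * m)) (halt : ∀ T, e T T = 1)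
    (hPT' : inv.SumInvLocalizationEqZero) (hβ' : D.β' = D.β) {S : Finset (Place K)}
    (hS : ∀ v ∉ S, D.localTerm inv v = 0) : D.sumOn inv S = 0 := by
  have hlr : ∀ v, inv v (galoisCohomology.localization (mu K (m * m)) v 2
      (twoCocycleClass _ (T.levelCocycle D halt hβ'))) = D.localTerm inv v := fun v =>
    (congrArg (inv v) (locClass₂_resTwo (mu K (m * m)) (Place.Completion v) (T.levelCocycle D halt hβ'))).symm.trans
      (T.inv_locClass₂_res_levelCocycle D v inv halt hβ')
  have hc : ∀ v ∉ S, inv v (galoisCohomology.localization (mu K (m * m)) v 2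
      (twoCocycleClass _ (T.levelCocycle D halt hβ'))) = 0 := fun v hv => by
    rw [hlr, hS v hv]
  have hsum := hPT' (twoCocycleClass _ (T.levelCocycle D halt hβ')) S hc
  rw [Finset.sum_congr rfl fun v _ => hlr v] at hsum
  exact hsum

end LevelThetaDatum

/-! ### Consequences for `ctGeneralFun` -/

section Pairing

variable (inv : LocalInvariants K (m * m)) (halt : ∀ T, e T T = 1) (hPT' : inv.SumInvLocalizationEqZero)
  (hH3 : ∀ c : galoisCohomology (mu K (m * m)) 3,
    (∀ v : Place K, galoisCohomology.localization (mu K (m * m)) v 3 c = 0) → c = 0)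
  (hfin : ∀ D : GeneralCaseData W m e hμ hadd₁ hadd₂ hgal, ∃ S : Finset (Place K), ∀ v ∉ S, D.localTerm inv v = 0)
include halt hPT' hH3 hfin

/-- **The general-case Cassels–Tate pairing is alternating at level `m`, `⟨a, a⟩ = 0`, given a theta group with
a level structure for `(E, m)`** (Morgan–Smith Thm. 5.10 with vanishing Poonen–Stoll class; the input
`hct_alt` of `CasselsTateLevelAssembly.isLevelPairing_ctLevelPairing` at ANY level, even or odd).
[cite: MorganSmith2021CTP, §5 Thm. 5.10] -/
theorem ctGeneralFun_self_eq_zero_of_levelThetaDatum [W.IsElliptic] (T : LevelThetaDatum W m e hμ hadd₁ hadd₂ l)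
    {a : W.galH1} (ha : a ∈ W.sha) (hma : (m : ℤ) • a = 0) :
    ctGeneralFun W m e hμ hadd₁ hadd₂ hgal inv a a = 0 := by
  obtain ⟨b, hbSel, rfl⟩ := exists_selmer_lift (W := W) (m := m) ha hma
  obtain ⟨D₀, hD₀b, -⟩ := GeneralCaseData.exists_generalCaseData (e := e) (hμ := hμ) (hadd₁ := hadd₁)
    (hadd₂ := hadd₂) (hgal := hgal) hH3 hbSel hbSel
  have hβSel : oneCocycleClass _ D₀.β ∈ selmerGroup W (m : ℤ) := by
    rw [D₀.hβ]
    exact D₀.b_mem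
  obtain ⟨ε, hε⟩ := D₀.exists_eps hH3 D₀.β
  let D : GeneralCaseData W m e hμ hadd₁ hadd₂ hgal := D₀.withRight D₀.β hβSel ε hε
  obtain ⟨S, hS⟩ := hfin D
  have h0 := T.sumOn_self_eq_zero D inv halt hPT' rfl hS
  have e1 : torsionH1ToH1 W (m : ℤ) D.b' = torsionH1ToH1 W (m : ℤ) b := by
    show torsionH1ToH1 W (m : ℤ) (oneCocycleClass (W.torsionGaloisModule (m : ℤ)).toTopRep D₀.β) = _
    rw [D₀.hβ, hD₀b]
  have e2 : torsionH1ToH1 W (m : ℤ) D.b = torsionH1ToH1 W (m : ℤ) b := by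
    show torsionH1ToH1 W (m : ℤ) D₀.b = _
    rw [hD₀b]
  have h := ctGeneralFun_eq inv halt hPT' D hS
  rw [e1, e2] at h
  rw [h]
  exact h0

end Pairing

end Level

end Literature.NumberTheory.EllipticCurves

end
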